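import Summits.Ventures.LatticeQCDFlow.Exactness.IMHAutocovLayerCake
import HarnessLib

/-!
# The EXACT integrated autocorrelation time of the flow sampler: a closed form in the weights

HONEST FRAMING: exact (Metropolis-corrected) sampling algorithms for lattice gauge theory;
figures of merit are autocorrelation/cost numbers at stated couplings and volumes; no
continuum-physics claim.  (SCALAR calibration rung S0-A: not a gauge result.)

Venture `LatticeQCDFlow` (cell pub-lqcd), topic `Exactness`; FANOUT row 2 (`s0-phi4`, FLOW arm:
normalizing-flow proposals + independence-Metropolis accept/reject).  NEW WORK of the cell: the
`N → ∞` limit of the layer-cake partial sums of `IMHAutocovLayerCake.lean` (monotone convergence,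
every term nonnegative), i.e. the Green–Kubo sum of the exact flow sampler in CLOSED FORM as a
functional of the joint target law of the pair (observable, importance weight).  Nothing is cited
as a fact (Smith–Tierney 1996 / Wang arXiv:2008.02455 NAMED ONLY for the `n`-step law behind it).

## What is proved (`w, q > 0` measurable integrable, `∫ q dμ = 1`, `b = w/q`, `K = imhOp μ w q`,
`λ = rejCurve μ w q` (`λ < 1` on `(0,∞)`), `G(u) = ∫ 1[b < u] g w dμ`, `g` bounded measurable,
`C(k) = ∫ g (Kᵏ g) w dμ`; the two WEIGHT FUNCTIONALS
`I = ∫_{u>0} G(u)² / (u(1 − λ(u)))² du` and `J = ∫ g² w λ(b)/(1 − λ(b)) dμ`)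

* `integrable_of_monotone_integral_le` (monotone convergence with bounded integrals, real
  form), `mul_one_sub_rejCurve` (`u(1 − λ(u)) = ∫ min(w, u q) dμ`, the clipped target mass),
  `layerLevel_facts` / `layerStick_facts` (the two monotone sequences of partial sums; the
  folklore series `Σ_k (k+1)lᵏ = 1/(1−l)²` is inlined);
* **`hasSum_autocov_layerCake`** — if the integrands of `I` and `J` are integrable then
  `Σ_{k≥0} C(k+1) = I + J` as a `HasSum`;
* **`integrable_layerCake_of_summable`** — conversely, if `Σ C(k+1)` is summable then both
  integrands are integrable; **`summable_autocov_iff`** — summability of the autocovariance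
  series of `g` is EQUIVALENT to `I, J < ∞`;
* **`imhOp_tauInt_eq`** — THE EXACT FORMULA: `τ_int(g) = ½ + (I + J) / ∫ g² w dμ`
  (`Scoring.tauInt`; also `imhOp_tauInt_eq_of_summable`);
* the lattice instances (`ℝ^Λ`, row 2's `imhOpPhi4 J λ q̃`) are in
  `Exactness/Phi4FlowTauIntExact.lean`.

Reading for S0-A (no numerics implied): for the flow arm `τ_int` of EVERY observable is a
deterministic functional of i.i.d. draws `(g, b)` under the target — the sticking part `J`
(rejection odds weighted by `g²`) plus a level integral `I` whose integrand at weight level `u` is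
`(∫_{b<u} g w / ∫ min(w, u q̃))²`, for centred `g` equivalently the squared `g`-charge of the
target ABOVE level `u` over the target mass clipped at `u`: the under-covered upper tail of the
weights is what drives `τ_int`.  Relation to the tree: `IMHStickingFloorSummed` is `τ ≥ ½ + J/∫g²w`
(drop `I ≥ 0`); row 8's finite-state `Scoring/IMHGreenKubo` is the Poisson-equation form.
NOT CLAIMED: HMC / local Metropolis; unbounded observables; any number for a trained network.
-/

namespace Summit.Ventures.LatticeQCDFlow.Exactness

open Real MeasureTheory Filter Set Topology
open Summit.Ventures.LatticeQCDFlow.Scoring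

/-! ## A monotone-convergence lemma -/

/-- Monotone convergence with bounded integrals gives an integrable limit (real form): a.e.
nonnegative integrable `f N ↑ F` a.e. with `∫ f N ≤ M` for all `N` ⇒ `F ∈ L¹` and `∫ F ≤ M`. -/
theorem integrable_of_monotone_integral_le {α : Type*} [MeasurableSpace α] {ν : Measure α}
    {f : ℕ → α → ℝ} {F : α → ℝ} (hfi : ∀ N, Integrable (f N) ν) (hf0 : ∀ N, 0 ≤ᵐ[ν] f N)
    (hmono : ∀ᵐ x ∂ν, Monotone fun N => f N x)
    (hlim : ∀ᵐ x ∂ν, Tendsto (fun N => f N x) atTop (𝓝 (F x))) {M : ℝ}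
    (hle : ∀ N, ∫ x, f N x ∂ν ≤ M) : Integrable F ν ∧ ∫ x, F x ∂ν ≤ M := by
  have hFm : AEStronglyMeasurable F ν :=
    aestronglyMeasurable_of_tendsto_ae atTop (fun N => (hfi N).aestronglyMeasurable) hlim
  have hall : ∀ᵐ x ∂ν, ∀ N, 0 ≤ f N x := ae_all_iff.2 fun N => hf0 N
  have hF0 : 0 ≤ᵐ[ν] F := by
    filter_upwards [hlim, hall] with x hx h0
    exact ge_of_tendsto' hx fun N => h0 N
  have hM : 0 ≤ M := (integral_nonneg_of_ae (hf0 0)).trans (hle 0)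
  have hL : Tendsto (fun N => ∫⁻ x, ENNReal.ofReal (f N x) ∂ν) atTop
      (𝓝 (∫⁻ x, ENNReal.ofReal (F x) ∂ν)) := by
    refine lintegral_tendsto_of_tendsto_of_monotone
      (fun N => (hfi N).aemeasurable.ennreal_ofReal) ?_ ?_
    · filter_upwards [hmono] with x hx N N' h using ENNReal.ofReal_le_ofReal (hx h)
    · filter_upwards [hlim] with x hx using ENNReal.tendsto_ofReal hx
  have hbound : ∫⁻ x, ENNReal.ofReal (F x) ∂ν ≤ ENNReal.ofReal M := by
    refine le_of_tendsto' hL fun N => ?_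
    rw [← ofReal_integral_eq_lintegral_ofReal (hfi N) (hf0 N)]
    exact ENNReal.ofReal_le_ofReal (hle N)
  have hFi : Integrable F ν := by
    refine ⟨hFm, ?_⟩
    rw [hasFiniteIntegral_iff_ofReal hF0]
    exact hbound.trans_lt ENNReal.ofReal_lt_top
  refine ⟨hFi, ?_⟩
  rw [integral_eq_lintegral_of_nonneg_ae hF0 hFm]
  exact ENNReal.toReal_le_of_le_ofReal hM hbound

variable {X : Type*} [MeasurableSpace X] {μ : Measure X} {w q : X → ℝ}

variable [SFinite μ]

omit [SFinite μ] in
/-- **The clipped target mass**: `u (1 − λ(u)) = ∫ min(w, u q) dμ` for `u > 0`. -/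
theorem mul_one_sub_rejCurve (hw0 : ∀ t, 0 < w t) (hwm : Measurable w) (hq0 : ∀ t, 0 < q t)
    (hqm : Measurable q) (hqi : Integrable q μ) (hq1 : ∫ z, q z ∂μ = 1) {u : ℝ} (hu : 0 < u) :
    u * (1 - rejCurve μ w q u) = ∫ z, min (w z) (u * q z) ∂μ := by
  have hint := integrable_rejCurve_integrand hw0 hwm hq0 hqm hqi hu
  have e : ∫ z, min (w z) (u * q z) ∂μ
      = u * ((∫ z, q z ∂μ) - ∫ z, (1 - min 1 (w z / q z / u)) * q z ∂μ) := by
    rw [← integral_sub hqi hint, ← integral_const_mul]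
    refine integral_congr_ae (Eventually.of_forall fun z => ?_)
    show min (w z) (u * q z) = u * (q z - (1 - min 1 (w z / q z / u)) * q z)
    have hqz := hq0 z
    have huq : 0 < u * q z := mul_pos hu hqz
    by_cases h : w z ≤ u * q z
    · rw [min_eq_left h, min_eq_right ((div_le_one hu).2 ((div_le_iff₀ hqz).2 h))]
      field_simp
      ring
    · have h' : u * q z < w z := not_le.1 h
      rw [min_eq_right h'.le, min_eq_left ((one_le_div hu).2 ((le_div_iff₀ hqz).2 h'.le))]
      ring
  unfold rejCurve
  rw [e, hq1]

/-! ## The two monotone sequences of layer-cake partial sums -/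

/-- The level sequence `f_N(u) = (Σ_{k<N} (k+1)λ(u)ᵏ)/u² · G(u)²` on `(0, ∞)`: integrable,
nonnegative, nondecreasing in `N`, and convergent to `G(u)²/(u(1 − λ(u)))²`. -/
theorem layerLevel_facts (hw0 : ∀ t, 0 < w t) (hwm : Measurable w) (hwi : Integrable w μ)
    (hq0 : ∀ t, 0 < q t) (hqm : Measurable q) (hqi : Integrable q μ) (hq1 : ∫ z, q z ∂μ = 1)
    {g : X → ℝ} (hgm : Measurable g) {B : ℝ} (hgb : ∀ t, |g t| ≤ B) :
    (∀ N, Integrable (fun u : ℝ => (∑ k ∈ Finset.range N, ((k : ℝ) + 1) * rejCurve μ w q u ^ k)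
        / u ^ 2 * (∫ x, (if w x / q x < u then g x * w x else 0) ∂μ) ^ 2)
        (volume.restrict (Ioi 0)))
    ∧ (∀ N, 0 ≤ᵐ[volume.restrict (Ioi 0)] fun u : ℝ =>
        (∑ k ∈ Finset.range N, ((k : ℝ) + 1) * rejCurve μ w q u ^ k)
          / u ^ 2 * (∫ x, (if w x / q x < u then g x * w x else 0) ∂μ) ^ 2)
    ∧ (∀ᵐ u ∂(volume.restrict (Ioi 0)), Monotone fun N : ℕ =>
        (∑ k ∈ Finset.range N, ((k : ℝ) + 1) * rejCurve μ w q u ^ k)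
          / u ^ 2 * (∫ x, (if w x / q x < u then g x * w x else 0) ∂μ) ^ 2)
    ∧ (∀ᵐ u ∂(volume.restrict (Ioi 0)), Tendsto (fun N : ℕ =>
        (∑ k ∈ Finset.range N, ((k : ℝ) + 1) * rejCurve μ w q u ^ k)
          / u ^ 2 * (∫ x, (if w x / q x < u then g x * w x else 0) ∂μ) ^ 2) atTop
        (𝓝 ((∫ x, (if w x / q x < u then g x * w x else 0) ∂μ) ^ 2
          / (u * (1 - rejCurve μ w q u)) ^ 2))) := by
  have hlam : ∀ u : ℝ, 0 < u → 0 ≤ rejCurve μ w q u ∧ rejCurve μ w q u < 1 := fun u hu =>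
    ⟨(rejCurve_bounds hw0 hq0 hqi hu (μ := μ)).1, rejCurve_lt_one hw0 hwm hq0 hqm hqi hq1 hu⟩
  have hterm0 : ∀ u : ℝ, 0 < u → ∀ k : ℕ, 0 ≤ ((k : ℝ) + 1) * rejCurve μ w q u ^ k :=
    fun u hu k => mul_nonneg (by positivity) (pow_nonneg (hlam u hu).1 k)
  refine ⟨fun N => ?_, fun N => ?_, ?_, ?_⟩
  · have h : Integrable (fun u : ℝ => ∑ k ∈ Finset.range N,
        ((k : ℝ) + 1) * rejCurve μ w q u ^ k / u ^ 2
          * (∫ x, (if w x / q x < u then g x * w x else 0) ∂μ) ^ 2) (volume.restrict (Ioi 0)) :=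
      integrable_finsetSum _ fun k _ =>
        integrableOn_stIntegrand_mul_sq hw0 hwm hwi hq0 hqm hqi hq1 k hgm hgb
    refine h.congr (Eventually.of_forall fun u => ?_)
    show ∑ k ∈ Finset.range N, ((k : ℝ) + 1) * rejCurve μ w q u ^ k / u ^ 2
          * (∫ x, (if w x / q x < u then g x * w x else 0) ∂μ) ^ 2
      = (∑ k ∈ Finset.range N, ((k : ℝ) + 1) * rejCurve μ w q u ^ k) / u ^ 2
          * (∫ x, (if w x / q x < u then g x * w x else 0) ∂μ) ^ 2
    rw [Finset.sum_div, Finset.sum_mul]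
  · refine (ae_restrict_iff' measurableSet_Ioi).2 (Eventually.of_forall fun u hu => ?_)
    exact mul_nonneg (div_nonneg (Finset.sum_nonneg fun k _ => hterm0 u hu k) (sq_nonneg _))
      (sq_nonneg _)
  · refine (ae_restrict_iff' measurableSet_Ioi).2 (Eventually.of_forall fun u hu N N' hNN' => ?_)
    refine mul_le_mul_of_nonneg_right (div_le_div_of_nonneg_right ?_ (sq_nonneg _)) (sq_nonneg _)
    exact Finset.sum_le_sum_of_subset_of_nonneg (Finset.range_mono hNN') fun k _ _ => hterm0 u hu k
  · refine (ae_restrict_iff' measurableSet_Ioi).2 (Eventually.of_forall fun u hu => ?_)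
    obtain ⟨hl0, hl1⟩ := hlam u hu
    have hne : 1 - rejCurve μ w q u ≠ 0 := (sub_pos.2 hl1).ne'
    -- the folklore series `Σ_k (k+1) lᵏ = 1/(1 − l)²`, `0 ≤ l < 1`
    have hsum : HasSum (fun k : ℕ => ((k : ℝ) + 1) * rejCurve μ w q u ^ k)
        (1 / (1 - rejCurve μ w q u) ^ 2) := by
      have hn : ‖rejCurve μ w q u‖ < 1 := by rw [Real.norm_eq_abs, abs_of_nonneg hl0]; exact hl1
      have h := (hasSum_coe_mul_geometric_of_norm_lt_one hn).add (hasSum_geometric_of_lt_one hl0 hl1)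
      have e1 : (fun k : ℕ => ((k : ℝ) + 1) * rejCurve μ w q u ^ k)
          = fun k : ℕ => (k : ℝ) * rejCurve μ w q u ^ k + rejCurve μ w q u ^ k := by
        funext k; ring
      have e2 : (1 : ℝ) / (1 - rejCurve μ w q u) ^ 2
          = rejCurve μ w q u / (1 - rejCurve μ w q u) ^ 2 + (1 - rejCurve μ w q u)⁻¹ := by
        field_simp; ring
      rw [e1, e2]; exact h
    have h := ((hsum.tendsto_sum_nat).div_const (u ^ 2)).mul_const
      ((∫ x, (if w x / q x < u then g x * w x else 0) ∂μ) ^ 2)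
    have hune : u ≠ 0 := hu.ne'
    convert h using 2
    field_simp

/-- The sticking sequence `f_N(x) = g² w Σ_{k<N} λ(b)^{k+1}`: integrable, nonnegative,
nondecreasing in `N`, and convergent to `g² w λ(b)/(1 − λ(b))`. -/
theorem layerStick_facts (hw0 : ∀ t, 0 < w t) (hwm : Measurable w) (hwi : Integrable w μ)
    (hq0 : ∀ t, 0 < q t) (hqm : Measurable q) (hqi : Integrable q μ) (hq1 : ∫ z, q z ∂μ = 1)
    {g : X → ℝ} (hgm : Measurable g) {B : ℝ} (hgb : ∀ t, |g t| ≤ B) :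
    (∀ N, Integrable (fun x => g x ^ 2 * w x
        * ∑ k ∈ Finset.range N, rejCurve μ w q (w x / q x) ^ (k + 1)) μ)
    ∧ (∀ N, 0 ≤ᵐ[μ] fun x => g x ^ 2 * w x
        * ∑ k ∈ Finset.range N, rejCurve μ w q (w x / q x) ^ (k + 1))
    ∧ (∀ᵐ x ∂μ, Monotone fun N : ℕ => g x ^ 2 * w x
        * ∑ k ∈ Finset.range N, rejCurve μ w q (w x / q x) ^ (k + 1))
    ∧ (∀ᵐ x ∂μ, Tendsto (fun N : ℕ => g x ^ 2 * w x
        * ∑ k ∈ Finset.range N, rejCurve μ w q (w x / q x) ^ (k + 1)) atTop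
        (𝓝 (g x ^ 2 * w x
          * (rejCurve μ w q (w x / q x) / (1 - rejCurve μ w q (w x / q x)))))) := by
  have hb0 : ∀ t, 0 < w t / q t := fun t => div_pos (hw0 t) (hq0 t)
  have hbm : Measurable fun t => w t / q t := hwm.div hqm
  have hlam : ∀ x, 0 ≤ rejCurve μ w q (w x / q x) ∧ rejCurve μ w q (w x / q x) < 1 := fun x =>
    ⟨(rejCurve_bounds hw0 hq0 hqi (hb0 x) (μ := μ)).1,
      rejCurve_lt_one hw0 hwm hq0 hqm hqi hq1 (hb0 x)⟩
  have hpow : ∀ x k, 0 ≤ rejCurve μ w q (w x / q x) ^ (k + 1)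
      ∧ rejCurve μ w q (w x / q x) ^ (k + 1) ≤ 1 := fun x k =>
    ⟨pow_nonneg (hlam x).1 _, pow_le_one₀ (hlam x).1 (hlam x).2.le⟩
  have hg2w : ∀ x, 0 ≤ g x ^ 2 * w x := fun x => mul_nonneg (sq_nonneg _) (hw0 x).le
  refine ⟨fun N => ?_, fun N => ?_, ?_, ?_⟩
  · have h : Integrable (fun x => ∑ k ∈ Finset.range N,
        g x ^ 2 * w x * rejCurve μ w q (w x / q x) ^ (k + 1)) μ :=
      integrable_finsetSum _ fun k _ => integrable_sq_mul_weight_mul hw0 hwm hwi hgm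
        (((measurable_rejCurve hwm hqm).comp hbm).pow_const _) hgb (fun x => (hpow x k).1)
        (fun x => (hpow x k).2)
    refine h.congr (Eventually.of_forall fun x => ?_)
    show ∑ k ∈ Finset.range N, g x ^ 2 * w x * rejCurve μ w q (w x / q x) ^ (k + 1)
      = g x ^ 2 * w x * ∑ k ∈ Finset.range N, rejCurve μ w q (w x / q x) ^ (k + 1)
    rw [Finset.mul_sum]
  · exact Eventually.of_forall fun x =>
      mul_nonneg (hg2w x) (Finset.sum_nonneg fun k _ => (hpow x k).1)
  · refine Eventually.of_forall fun x N N' hNN' => ?_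
    exact mul_le_mul_of_nonneg_left (Finset.sum_le_sum_of_subset_of_nonneg
      (Finset.range_mono hNN') fun k _ _ => (hpow x k).1) (hg2w x)
  · refine Eventually.of_forall fun x => ?_
    have habs : |rejCurve μ w q (w x / q x)| < 1 := by
      rw [abs_of_nonneg (hlam x).1]; exact (hlam x).2
    exact ((hasSum_geometric_succ habs).tendsto_sum_nat).const_mul _

/-! ## The Green–Kubo sum in closed form -/

/-- **THE GREEN–KUBO SUM OF THE EXACT FLOW SAMPLER IN CLOSED FORM.**  `w, q > 0` measurable
integrable, `∫ q = 1`, `b = w/q`, `λ` the rejection curve, `g` bounded measurable,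
`G(u) = ∫ 1[b < u] g w dμ`.  If `u ↦ G(u)²/(u(1 − λ(u)))²` is integrable on `(0, ∞)` and
`g² w λ(b)/(1 − λ(b))` is integrable, then
`Σ_{k ≥ 0} ∫ g (K^{k+1} g) w dμ = ∫_{u>0} G(u)²/(u(1 − λ(u)))² du + ∫ g² w λ(b)/(1 − λ(b)) dμ`. -/
theorem hasSum_autocov_layerCake (hw0 : ∀ t, 0 < w t) (hwm : Measurable w)
    (hwi : Integrable w μ) (hq0 : ∀ t, 0 < q t) (hqm : Measurable q) (hqi : Integrable q μ)
    (hq1 : ∫ z, q z ∂μ = 1) {g : X → ℝ} (hgm : Measurable g) {B : ℝ} (hgb : ∀ t, |g t| ≤ B)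
    (hI : IntegrableOn (fun u : ℝ => (∫ x, (if w x / q x < u then g x * w x else 0) ∂μ) ^ 2
      / (u * (1 - rejCurve μ w q u)) ^ 2) (Ioi 0))
    (hJ : Integrable (fun x => g x ^ 2 * w x
      * (rejCurve μ w q (w x / q x) / (1 - rejCurve μ w q (w x / q x)))) μ) :
    HasSum (fun k => ∫ x, g x * ((imhOp μ w q)^[k + 1] g) x * w x ∂μ)
      ((∫ u in Ioi (0:ℝ), (∫ x, (if w x / q x < u then g x * w x else 0) ∂μ) ^ 2
          / (u * (1 - rejCurve μ w q u)) ^ 2)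
        + ∫ x, g x ^ 2 * w x
          * (rejCurve μ w q (w x / q x) / (1 - rejCurve μ w q (w x / q x))) ∂μ) := by
  obtain ⟨hIi, -, hImono, hIlim⟩ := layerLevel_facts hw0 hwm hwi hq0 hqm hqi hq1 hgm hgb
  obtain ⟨hJi, -, hJmono, hJlim⟩ := layerStick_facts hw0 hwm hwi hq0 hqm hqi hq1 hgm hgb
  have hTI := integral_tendsto_of_tendsto_of_monotone hIi hI hImono hIlim
  have hTJ := integral_tendsto_of_tendsto_of_monotone hJi hJ hJmono hJlim
  rw [hasSum_iff_tendsto_nat_of_nonneg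
    (fun k => autocov_nonneg hw0 hwm hwi hq0 hqm hqi hq1 hgm hgb (k + 1))]
  refine (hTI.add hTJ).congr fun N => ?_
  exact (autocov_partialSum_eq_layerCake hw0 hwm hwi hq0 hqm hqi hq1 hgm hgb N).symm

/-- **SUMMABLE ⇒ FINITE WEIGHT FUNCTIONALS.**  If the autocovariance series of the bounded
measurable `g` along the exact chain is summable, then `u ↦ G(u)²/(u(1 − λ(u)))²` is integrable
on `(0, ∞)` and `g² w λ(b)/(1 − λ(b))` is integrable (monotone convergence: every partial
layer-cake sum is below the total). -/
theorem integrable_layerCake_of_summable (hw0 : ∀ t, 0 < w t) (hwm : Measurable w)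
    (hwi : Integrable w μ) (hq0 : ∀ t, 0 < q t) (hqm : Measurable q) (hqi : Integrable q μ)
    (hq1 : ∫ z, q z ∂μ = 1) {g : X → ℝ} (hgm : Measurable g) {B : ℝ} (hgb : ∀ t, |g t| ≤ B)
    (hs : Summable fun k => ∫ x, g x * ((imhOp μ w q)^[k + 1] g) x * w x ∂μ) :
    IntegrableOn (fun u : ℝ => (∫ x, (if w x / q x < u then g x * w x else 0) ∂μ) ^ 2
        / (u * (1 - rejCurve μ w q u)) ^ 2) (Ioi 0)
    ∧ Integrable (fun x => g x ^ 2 * w x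
        * (rejCurve μ w q (w x / q x) / (1 - rejCurve μ w q (w x / q x)))) μ := by
  obtain ⟨hIi, hI0, hImono, hIlim⟩ := layerLevel_facts hw0 hwm hwi hq0 hqm hqi hq1 hgm hgb
  obtain ⟨hJi, hJ0, hJmono, hJlim⟩ := layerStick_facts hw0 hwm hwi hq0 hqm hqi hq1 hgm hgb
  set T := ∑' k, ∫ x, g x * ((imhOp μ w q)^[k + 1] g) x * w x ∂μ with hT
  have hST : ∀ N, ∑ k ∈ Finset.range N, ∫ x, g x * ((imhOp μ w q)^[k + 1] g) x * w x ∂μ ≤ T :=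
    fun N => hs.sum_le_tsum (Finset.range N) fun k _ =>
      autocov_nonneg hw0 hwm hwi hq0 hqm hqi hq1 hgm hgb (k + 1)
  have hIN0 : ∀ N, 0 ≤ ∫ u in Ioi (0:ℝ), (∑ k ∈ Finset.range N,
      ((k : ℝ) + 1) * rejCurve μ w q u ^ k) / u ^ 2
        * (∫ x, (if w x / q x < u then g x * w x else 0) ∂μ) ^ 2 :=
    fun N => integral_nonneg_of_ae (hI0 N)
  have hJN0 : ∀ N, 0 ≤ ∫ x, g x ^ 2 * w x
      * ∑ k ∈ Finset.range N, rejCurve μ w q (w x / q x) ^ (k + 1) ∂μ :=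
    fun N => integral_nonneg_of_ae (hJ0 N)
  have hsplit := fun N => autocov_partialSum_eq_layerCake hw0 hwm hwi hq0 hqm hqi hq1 hgm hgb N
  have hIle : ∀ N, ∫ u in Ioi (0:ℝ), (∑ k ∈ Finset.range N,
      ((k : ℝ) + 1) * rejCurve μ w q u ^ k) / u ^ 2
        * (∫ x, (if w x / q x < u then g x * w x else 0) ∂μ) ^ 2 ≤ T := fun N => by
    have h1 := hST N; have h2 := hsplit N; have h3 := hJN0 N
    linarith
  have hJle : ∀ N, ∫ x, g x ^ 2 * w x
      * ∑ k ∈ Finset.range N, rejCurve μ w q (w x / q x) ^ (k + 1) ∂μ ≤ T := fun N => by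
    have h1 := hST N; have h2 := hsplit N; have h3 := hIN0 N
    linarith
  exact ⟨(integrable_of_monotone_integral_le hIi hI0 hImono hIlim hIle).1,
    (integrable_of_monotone_integral_le hJi hJ0 hJmono hJlim hJle).1⟩

/-- **SUMMABILITY CRITERION.**  The autocovariance series of a bounded measurable `g` along the
exact flow sampler is summable IF AND ONLY IF the two weight functionals are finite:
`∫_{u>0} G(u)²/(u(1 − λ(u)))² du < ∞` and `∫ g² w λ(b)/(1 − λ(b)) dμ < ∞`. -/
theorem summable_autocov_iff (hw0 : ∀ t, 0 < w t) (hwm : Measurable w)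
    (hwi : Integrable w μ) (hq0 : ∀ t, 0 < q t) (hqm : Measurable q) (hqi : Integrable q μ)
    (hq1 : ∫ z, q z ∂μ = 1) {g : X → ℝ} (hgm : Measurable g) {B : ℝ} (hgb : ∀ t, |g t| ≤ B) :
    (Summable fun k => ∫ x, g x * ((imhOp μ w q)^[k + 1] g) x * w x ∂μ)
      ↔ IntegrableOn (fun u : ℝ => (∫ x, (if w x / q x < u then g x * w x else 0) ∂μ) ^ 2
            / (u * (1 - rejCurve μ w q u)) ^ 2) (Ioi 0)
        ∧ Integrable (fun x => g x ^ 2 * w x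
            * (rejCurve μ w q (w x / q x) / (1 - rejCurve μ w q (w x / q x)))) μ :=
  ⟨fun hs => integrable_layerCake_of_summable hw0 hwm hwi hq0 hqm hqi hq1 hgm hgb hs,
    fun h => (hasSum_autocov_layerCake hw0 hwm hwi hq0 hqm hqi hq1 hgm hgb h.1 h.2).summable⟩

/-- **THE EXACT INTEGRATED AUTOCORRELATION TIME OF THE FLOW SAMPLER.**  `w, q > 0` measurable
integrable, `∫ q = 1`, `b = w/q`, `λ` the rejection curve, `g` bounded measurable with finite
weight functionals.  On the tree's `Scoring.tauInt` (`τ_int = ½ + Σ_{k≥1} ρ(k)`,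
`ρ(k) = ∫ g (Kᵏ g) w / ∫ g² w`):
`τ_int = ½ + [∫_{u>0} G(u)²/(u(1 − λ(u)))² du + ∫ g² w λ(b)/(1 − λ(b)) dμ] / ∫ g² w dμ`. -/
theorem imhOp_tauInt_eq (hw0 : ∀ t, 0 < w t) (hwm : Measurable w)
    (hwi : Integrable w μ) (hq0 : ∀ t, 0 < q t) (hqm : Measurable q) (hqi : Integrable q μ)
    (hq1 : ∫ z, q z ∂μ = 1) {g : X → ℝ} (hgm : Measurable g) {B : ℝ} (hgb : ∀ t, |g t| ≤ B)
    (hI : IntegrableOn (fun u : ℝ => (∫ x, (if w x / q x < u then g x * w x else 0) ∂μ) ^ 2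
      / (u * (1 - rejCurve μ w q u)) ^ 2) (Ioi 0))
    (hJ : Integrable (fun x => g x ^ 2 * w x
      * (rejCurve μ w q (w x / q x) / (1 - rejCurve μ w q (w x / q x)))) μ) :
    tauInt (fun k => (∫ x, g x * ((imhOp μ w q)^[k] g) x * w x ∂μ) / ∫ x, g x ^ 2 * w x ∂μ)
      = 1 / 2 + ((∫ u in Ioi (0:ℝ), (∫ x, (if w x / q x < u then g x * w x else 0) ∂μ) ^ 2
            / (u * (1 - rejCurve μ w q u)) ^ 2)
          + ∫ x, g x ^ 2 * w x
            * (rejCurve μ w q (w x / q x) / (1 - rejCurve μ w q (w x / q x))) ∂μ)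
          / ∫ x, g x ^ 2 * w x ∂μ := by
  have h := (hasSum_autocov_layerCake hw0 hwm hwi hq0 hqm hqi hq1 hgm hgb hI hJ).div_const
    (∫ x, g x ^ 2 * w x ∂μ)
  simp only [tauInt]
  rw [h.tsum_eq]

/-- The exact formula under the chain-side hypothesis: if the autocovariance series is summable,
`τ_int = ½ + (I + J)/∫ g² w` with the two weight functionals `I`, `J` (finite by
`integrable_layerCake_of_summable`). -/
theorem imhOp_tauInt_eq_of_summable (hw0 : ∀ t, 0 < w t) (hwm : Measurable w)
    (hwi : Integrable w μ) (hq0 : ∀ t, 0 < q t) (hqm : Measurable q) (hqi : Integrable q μ)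
    (hq1 : ∫ z, q z ∂μ = 1) {g : X → ℝ} (hgm : Measurable g) {B : ℝ} (hgb : ∀ t, |g t| ≤ B)
    (hs : Summable fun k => ∫ x, g x * ((imhOp μ w q)^[k + 1] g) x * w x ∂μ) :
    tauInt (fun k => (∫ x, g x * ((imhOp μ w q)^[k] g) x * w x ∂μ) / ∫ x, g x ^ 2 * w x ∂μ)
      = 1 / 2 + ((∫ u in Ioi (0:ℝ), (∫ x, (if w x / q x < u then g x * w x else 0) ∂μ) ^ 2
            / (u * (1 - rejCurve μ w q u)) ^ 2)
          + ∫ x, g x ^ 2 * w x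
            * (rejCurve μ w q (w x / q x) / (1 - rejCurve μ w q (w x / q x))) ∂μ)
          / ∫ x, g x ^ 2 * w x ∂μ := by
  obtain ⟨hI, hJ⟩ := integrable_layerCake_of_summable hw0 hwm hwi hq0 hqm hqi hq1 hgm hgb hs
  exact imhOp_tauInt_eq hw0 hwm hwi hq0 hqm hqi hq1 hgm hgb hI hJ

end Summit.Ventures.LatticeQCDFlow.Exactness
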